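import Literature.Barriers.Parity.SiegelZeroDichotomyPairHLMainTermSums
import Literature.Barriers.Parity.SiegelZeroDichotomyPairHLProp81Kernel
import Literature.Barriers.Parity.SiegelZeroDichotomyPairHLKernelCrude
import Literature.NumberTheory.LFunctions.MertensTail
import HarnessLib

/-!
# Tao–Teräväinen 2022, §8 (`k = 2`): the refined bound (8.20) for the Euler product of the kernel (`KB2`)

Topic `Literature/Barriers/Parity`, sub-namespace `TaoTeravainen`; the second kernel bound of the §8
assembly (`SiegelZeroDichotomyPairHLProp81Kernel.lean`, `…Prop81Final3.lean`), in the proof DAG of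
`Literature.Barriers.Parity.TaoTeravainen2021_prop72_81_pair` (T. Tao, J. Teräväinen, *The
Hardy–Littlewood–Chowla conjecture in the presence of a Siegel zero*, J. London Math. Soc. (2) 106 (2022),
arXiv:2109.06291), §8 (8.20): "From Taylor expansion one has the more precise bound
`E_p = 1 − k/p + O((1+|t|)³ log_R p/p) + O(1/p²)` when `p ≤ R`. Using this bound in place of the crude one
when `log p ≤ (1+|t|)^{-3} log R` and using Mertens' theorem, we obtain the refined estimate (8.20)
`∏_{p≥C} E_p ≪_C (1+|t|)^{O(1)} log^{-k} R`." Here `k = 2`; everything is PROVED, with explicit (large)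
constants and uniformly in ALL Fourier variables:

* `norm_cCoeff_add_one_le` — `‖c_p + 1‖ ≤ 2 β₁β₂` (`β_i = ‖1 − v_i‖`);
* `norm_localE_sub_main_le` — for `p ∤ Δ`: `‖E_p − (1 − 2/p)‖ ≤ 4 (β₁₀β₂₀ + β₁₁β₂₁)/p`, hence the two
  regimes `‖E_p‖ ≤ exp(−2/p + 4B/p)` and `‖E_p‖ ≤ exp(32/p)`;
* `norm_prod_localE_refined` — `‖∏_{p<N} E_p‖ ≤ C(Δ) (1+S)^{17} (log N)^{32} (log R)^{-34}`-type bound where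
  `S = σ₁₀σ₂₀ + σ₁₁σ₂₁`, `β_{ij} ≤ σ_{ij} log_R p` (split at `R₁ = R^{1/(2√(1+S))}`, Mertens' bounds both ways);
* **`kernel_KB2`** — the bound for `assemblyKernel` in the form consumed by `prop72_81_pair_of_kernelBounds`.
  [cite: TaoTeravainen2021, §8 (8.20)]
-/

noncomputable section

open Finset Real Complex

namespace Literature.Barriers.Parity

namespace TaoTeravainen

open Literature.NumberTheory.LFunctions.MertensBound (sum_inv_prime_le loglog_sub_loglog_le_sum_inv_prime_Icc)

variable {q : ℕ}

/-! ### One prime, `p ∤ Δ` -/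

/-- **`‖c_p + 1‖ ≤ 2 ‖1−v₁‖ ‖1−v₂‖`** (`|χ(p)| ≤ 1`, `‖u‖ ≤ 1`): `c_p + 1 = (1 + χ(p)u)(1−v₁)(1−v₂)`.
[cite: TaoTeravainen2021, §8 (8.22)] -/
theorem norm_cCoeff_add_one_le {χp : ℝ} (hχ : |χp| ≤ 1) {u v₁ v₂ : ℂ} (hu : ‖u‖ ≤ 1) :
    ‖MainTerm.cCoeff χp u v₁ v₂ + 1‖ ≤ 2 * (‖1 - v₁‖ * ‖1 - v₂‖) := by
  unfold MainTerm.cCoeff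
  rw [sub_add_cancel, norm_mul, norm_mul, mul_assoc]
  refine mul_le_mul_of_nonneg_right ?_ (by positivity)
  calc ‖1 + (χp : ℂ) * u‖ ≤ ‖(1 : ℂ)‖ + ‖(χp : ℂ) * u‖ := norm_add_le _ _
    _ ≤ 1 + 1 * 1 := by
        rw [norm_one, norm_mul, Complex.norm_real, Real.norm_eq_abs]
        gcongr
    _ = 2 := by norm_num

/-- **`E_p = 1 − 2/p + O(B/p)`** for `p ∤ Δ` (`v_H = 0`), `p ≥ 2`, `L ≥ 1`, `|χ(p)| ≤ 1`, `‖u_j‖ ≤ 1`,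
`‖v_{ij}‖ ≤ 1`: `‖E_p − (1 − 2/p)‖ ≤ 4 (β₁₀β₂₀ + β₁₁β₂₁)/p` with `β_{ij} = ‖1 − v_i j‖`.
[cite: TaoTeravainen2021, §8 ("E_p = 1 − k/p + O(…)")] -/
theorem norm_localE_sub_main_le {p : ℕ} (hp : 2 ≤ p) {L : ℕ} (hL : 1 ≤ L) {χp : ℝ} (hχ : |χp| ≤ 1)
    {u v₁ v₂ : Fin 2 → ℂ} (hu : ∀ j, ‖u j‖ ≤ 1) :
    ‖MainTerm.localE p 0 L χp u v₁ v₂ - (1 - 2 / (p : ℂ))‖ ≤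
      4 * (‖1 - v₁ 0‖ * ‖1 - v₂ 0‖ + ‖1 - v₁ 1‖ * ‖1 - v₂ 1‖) / p := by
  have hp0 : p ≠ 0 := by omega
  have hpR : (0 : ℝ) < p := by exact_mod_cast Nat.pos_of_ne_zero hp0
  have hp1 : (1 : ℝ) ≤ p := by exact_mod_cast (show 1 ≤ p by omega)
  have hnp : ‖(p : ℂ)‖ = p := Complex.norm_natCast p
  rw [MainTerm.localE_eq_of_vH_zero, MainTerm.sideSum_eq hp0 hL, MainTerm.sideSum_eq hp0 hL]
  -- each side: `(c + 1)/p + g`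
  have hside : ∀ j : Fin 2, ‖MainTerm.cCoeff χp (u j) (v₁ j) (v₂ j) / p + MainTerm.gTail p L χp (u j) (v₁ j) (v₂ j) + 1 / p‖ ≤
      4 * (‖1 - v₁ j‖ * ‖1 - v₂ j‖) / p := by
    intro j
    have h1 : ‖(MainTerm.cCoeff χp (u j) (v₁ j) (v₂ j) + 1) / (p : ℂ)‖ ≤ 2 * (‖1 - v₁ j‖ * ‖1 - v₂ j‖) / p := by
      rw [norm_div, hnp]; exact div_le_div_of_nonneg_right (norm_cCoeff_add_one_le hχ (hu j)) hpR.le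
    have h2 : ‖MainTerm.gTail p L χp (u j) (v₁ j) (v₂ j)‖ ≤ 2 * (‖1 - v₁ j‖ * ‖1 - v₂ j‖) / p := by
      refine (MainTerm.norm_gTail_le hp L hχ (hu j)).trans ?_
      rw [norm_mul]
      have hb : 0 ≤ ‖1 - v₁ j‖ * ‖1 - v₂ j‖ := by positivity
      -- `2/p² ≤ 2/p`
      have : 2 / (p : ℝ) ^ 2 ≤ 2 / p := div_le_div_of_nonneg_left (by norm_num) hpR (by nlinarith)
      calc ‖1 - v₁ j‖ * ‖1 - v₂ j‖ * (2 / (p : ℝ) ^ 2) ≤ ‖1 - v₁ j‖ * ‖1 - v₂ j‖ * (2 / p) := mul_le_mul_of_nonneg_left this hb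
        _ = 2 * (‖1 - v₁ j‖ * ‖1 - v₂ j‖) / p := by ring
    calc ‖MainTerm.cCoeff χp (u j) (v₁ j) (v₂ j) / p + MainTerm.gTail p L χp (u j) (v₁ j) (v₂ j) + 1 / p‖
        = ‖(MainTerm.cCoeff χp (u j) (v₁ j) (v₂ j) + 1) / (p : ℂ) + MainTerm.gTail p L χp (u j) (v₁ j) (v₂ j)‖ := by ring_nf
      _ ≤ ‖(MainTerm.cCoeff χp (u j) (v₁ j) (v₂ j) + 1) / (p : ℂ)‖ + ‖MainTerm.gTail p L χp (u j) (v₁ j) (v₂ j)‖ := norm_add_le _ _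
      _ ≤ 2 * (‖1 - v₁ j‖ * ‖1 - v₂ j‖) / p + 2 * (‖1 - v₁ j‖ * ‖1 - v₂ j‖) / p := add_le_add h1 h2
      _ = 4 * (‖1 - v₁ j‖ * ‖1 - v₂ j‖) / p := by ring
  calc ‖1 + (MainTerm.cCoeff χp (u 0) (v₁ 0) (v₂ 0) / p + MainTerm.gTail p L χp (u 0) (v₁ 0) (v₂ 0)) +
        (MainTerm.cCoeff χp (u 1) (v₁ 1) (v₂ 1) / p + MainTerm.gTail p L χp (u 1) (v₁ 1) (v₂ 1)) - (1 - 2 / (p : ℂ))‖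
      = ‖(MainTerm.cCoeff χp (u 0) (v₁ 0) (v₂ 0) / p + MainTerm.gTail p L χp (u 0) (v₁ 0) (v₂ 0) + 1 / p) +
          (MainTerm.cCoeff χp (u 1) (v₁ 1) (v₂ 1) / p + MainTerm.gTail p L χp (u 1) (v₁ 1) (v₂ 1) + 1 / p)‖ := by ring_nf
    _ ≤ 4 * (‖1 - v₁ 0‖ * ‖1 - v₂ 0‖) / p + 4 * (‖1 - v₁ 1‖ * ‖1 - v₂ 1‖) / p := (norm_add_le _ _).trans (add_le_add (hside 0) (hside 1))
    _ = _ := by ring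

/-- **The two regimes for one prime** (`p ∤ Δ`, `p ≥ 2`): with `B = β₁₀β₂₀ + β₁₁β₂₁ ≤ 8`,
`‖E_p‖ ≤ exp(−2/p + 4B/p)` and `‖E_p‖ ≤ exp(30/p)`. [cite: TaoTeravainen2021, §8 (8.20)] -/
theorem norm_localE_le_exp {p : ℕ} (hp : 2 ≤ p) {L : ℕ} (hL : 1 ≤ L) {χp : ℝ} (hχ : |χp| ≤ 1)
    {u v₁ v₂ : Fin 2 → ℂ} (hu : ∀ j, ‖u j‖ ≤ 1) (hv₁ : ∀ j, ‖v₁ j‖ ≤ 1) (hv₂ : ∀ j, ‖v₂ j‖ ≤ 1) :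
    ‖MainTerm.localE p 0 L χp u v₁ v₂‖ ≤
        Real.exp (-(2 / (p : ℝ)) + 4 * (‖1 - v₁ 0‖ * ‖1 - v₂ 0‖ + ‖1 - v₁ 1‖ * ‖1 - v₂ 1‖) / p) ∧
      ‖MainTerm.localE p 0 L χp u v₁ v₂‖ ≤ Real.exp (30 / (p : ℝ)) := by
  have hpR : (2 : ℝ) ≤ p := by exact_mod_cast hp
  have hp0 : (0 : ℝ) < p := by linarith
  have h := norm_localE_sub_main_le hp hL hχ hu (v₁ := v₁) (v₂ := v₂)
  set B := ‖1 - v₁ 0‖ * ‖1 - v₂ 0‖ + ‖1 - v₁ 1‖ * ‖1 - v₂ 1‖ with hB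
  have hB0 : 0 ≤ B := by positivity
  have hβ : ∀ (w : ℂ), ‖w‖ ≤ 1 → ‖1 - w‖ ≤ 2 := fun w hw => (norm_sub_le _ _).trans (by rw [norm_one]; linarith)
  have hB8 : B ≤ 8 := by
    have h1 := mul_le_mul (hβ _ (hv₁ 0)) (hβ _ (hv₂ 0)) (norm_nonneg _) zero_le_two
    have h2 := mul_le_mul (hβ _ (hv₁ 1)) (hβ _ (hv₂ 1)) (norm_nonneg _) zero_le_two
    rw [hB]; linarith
  have hmain : ‖(1 : ℂ) - 2 / (p : ℂ)‖ = 1 - 2 / (p : ℝ) := by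
    rw [show (1 : ℂ) - 2 / (p : ℂ) = (((1 - 2 / (p : ℝ) : ℝ)) : ℂ) by push_cast; ring, Complex.norm_real, Real.norm_eq_abs,
      abs_of_nonneg (by rw [sub_nonneg, div_le_one hp0]; exact hpR)]
  have hE : ‖MainTerm.localE p 0 L χp u v₁ v₂‖ ≤ (1 - 2 / (p : ℝ)) + 4 * B / p := by
    calc ‖MainTerm.localE p 0 L χp u v₁ v₂‖
        = ‖(MainTerm.localE p 0 L χp u v₁ v₂ - (1 - 2 / (p : ℂ))) + (1 - 2 / (p : ℂ))‖ := by rw [sub_add_cancel]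
      _ ≤ ‖MainTerm.localE p 0 L χp u v₁ v₂ - (1 - 2 / (p : ℂ))‖ + ‖(1 : ℂ) - 2 / (p : ℂ)‖ := norm_add_le _ _
      _ ≤ 4 * B / p + (1 - 2 / (p : ℝ)) := add_le_add h (le_of_eq hmain)
      _ = _ := by ring
  constructor
  · refine hE.trans ?_
    have := Real.add_one_le_exp (-(2 / (p : ℝ)) + 4 * B / p)
    linarith
  · refine hE.trans ?_
    have h32 : 4 * B / p ≤ 32 / p := by
      rw [div_le_div_iff_of_pos_right hp0]; linarith
    have := Real.add_one_le_exp (30 / (p : ℝ))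
    have h2 : 0 ≤ 2 / (p : ℝ) := by positivity
    nlinarith [h32, this, h2, show (30 : ℝ) / p = 32 / p - 2 / p by ring]

/-! ### The product over the primes below `N` -/

/-- The constant of the refined bound: `972^{ω} · 4 log²2 · e^{12/log 2 + ω + 3} · e^{720} 2^{30}`. [folklore] -/
def refinedConst (ω : ℕ) : ℝ :=
  972 ^ ω * (4 * Real.log 2 ^ 2 * Real.exp (12 / Real.log 2 + ω + 3)) * (Real.exp 720 * 2 ^ 30)

/-- `0 ≤ refinedConst`. [folklore] -/
theorem refinedConst_nonneg (ω : ℕ) : 0 ≤ refinedConst ω := by unfold refinedConst; positivity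

set_option maxHeartbeats 1600000 in
/-- **The refined bound for the product** ((8.20) at `k = 2`, explicit): for `Δ ≠ 0`, `L ≥ 1`,
`1 < R ≤ N`, `|χ(p)| ≤ 1`, side data of norm `≤ 1` with `β₁ⱼ(p)β₂ⱼ(p)` summing to `≤ S (log p/log R)²`
(`S ≥ 0`), `‖∏_{p<N} E_p‖ ≤ refinedConst(ω(Δ)) · (1+S)^{16} (log N)^{30} (log R)^{-32}`.
[cite: TaoTeravainen2021, §8 (8.20)] -/
theorem norm_prod_localE_refined {Δ : ℕ} (hΔ : Δ ≠ 0) {L : ℕ} (hL : 1 ≤ L) {N : ℕ} (hN : 2 ≤ N) {R : ℝ}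
    (hR : 1 < R) (hRN : R ≤ N) (χp : ℕ → ℝ) (hχ : ∀ p, |χp p| ≤ 1) (u v₁ v₂ : ℕ → Fin 2 → ℂ)
    (hu : ∀ p j, ‖u p j‖ ≤ 1) (hv₁ : ∀ p j, ‖v₁ p j‖ ≤ 1) (hv₂ : ∀ p j, ‖v₂ p j‖ ≤ 1) {S : ℝ} (hS : 0 ≤ S)
    (hB : ∀ p ∈ Nat.primesBelow N, ‖1 - v₁ p 0‖ * ‖1 - v₂ p 0‖ + ‖1 - v₁ p 1‖ * ‖1 - v₂ p 1‖ ≤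
      S * (Real.log p / Real.log R) ^ 2) :
    ‖∏ p ∈ Nat.primesBelow N, MainTerm.localE p (Δ.factorization p) L (χp p) (u p) (v₁ p) (v₂ p)‖ ≤
      refinedConst Δ.primeFactors.card * (1 + S) ^ 16 * Real.log N ^ 30 * (Real.log R ^ 32)⁻¹ := by
  classical
  set P := Nat.primesBelow N with hP
  set ω := Δ.primeFactors.card with hω
  have hPp : ∀ p ∈ P, p.Prime := fun p hp => Nat.prime_of_mem_primesBelow hp
  have hlogR : 0 < Real.log R := Real.log_pos hR
  have hNR : (2 : ℝ) ≤ N := by exact_mod_cast hN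
  have hlogN : 0 < Real.log N := Real.log_pos (by linarith)
  have hS1 : 1 ≤ 1 + S := by linarith
  have hsq : 1 ≤ Real.sqrt (1 + S) := by rw [Real.le_sqrt (by norm_num) (by linarith)]; linarith
  have hsq0 : 0 < Real.sqrt (1 + S) := by linarith
  have hsqsq : Real.sqrt (1 + S) ^ 2 = 1 + S := Real.sq_sqrt (by linarith)
  -- the splitting level `R₁ = R^{1/(2√(1+S))}`
  set ℓ : ℝ := Real.log R / (2 * Real.sqrt (1 + S)) with hℓ
  have hℓpos : 0 < ℓ := by positivity
  set R₁ : ℝ := Real.exp ℓ with hR₁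
  have hlogR₁ : Real.log R₁ = ℓ := Real.log_exp ℓ
  have hR₁1 : 1 ≤ R₁ := by rw [hR₁]; exact Real.one_le_exp hℓpos.le
  have hR₁R : R₁ < N := by
    have h1 : ℓ < Real.log R := by
      rw [hℓ, div_lt_iff₀ (by positivity)]; nlinarith
    calc R₁ = Real.exp ℓ := rfl
      _ < Real.exp (Real.log R) := Real.exp_lt_exp.mpr h1
      _ = R := Real.exp_log (by linarith)
      _ ≤ N := hRN
  -- the three sets
  set Pd := P.filter (fun p => p ∣ Δ) with hPd
  set Pn := P.filter (fun p => ¬p ∣ Δ) with hPn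
  set Pg := Pn.filter (fun p : ℕ => (p : ℝ) ≤ R₁) with hPg
  set Pb := Pn.filter (fun p : ℕ => ¬(p : ℝ) ≤ R₁) with hPb
  have hPd_card : Pd.card ≤ ω := by
    refine card_le_card fun p hp => ?_
    rw [hPd, mem_filter] at hp
    exact Nat.mem_primeFactors.mpr ⟨hPp p hp.1, hp.2, hΔ⟩
  have hnorm_le : ∀ p ∈ Pn, ‖MainTerm.localE p (Δ.factorization p) L (χp p) (u p) (v₁ p) (v₂ p)‖ ≤
      Real.exp (-(2 / (p : ℝ)) + 4 * (S * (Real.log p / Real.log R) ^ 2) / p) ∧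
      ‖MainTerm.localE p (Δ.factorization p) L (χp p) (u p) (v₁ p) (v₂ p)‖ ≤ Real.exp (30 / (p : ℝ)) := by
    intro p hp
    rw [hPn, mem_filter] at hp
    have hpr := hPp p hp.1
    rw [Nat.factorization_eq_zero_of_not_dvd hp.2]
    obtain ⟨h1, h2⟩ := norm_localE_le_exp hpr.two_le hL (hχ p) (hu p) (hv₁ p) (hv₂ p)
    refine ⟨h1.trans (Real.exp_le_exp.mpr ?_), h2⟩
    have hp0 : (0 : ℝ) < p := by exact_mod_cast hpr.pos
    have := hB p hp.1
    gcongr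
  -- (a) the primes dividing `Δ`
  have ha : ‖∏ p ∈ Pd, MainTerm.localE p (Δ.factorization p) L (χp p) (u p) (v₁ p) (v₂ p)‖ ≤ 972 ^ ω := by
    rw [norm_prod]
    calc ∏ p ∈ Pd, ‖MainTerm.localE p (Δ.factorization p) L (χp p) (u p) (v₁ p) (v₂ p)‖ ≤ ∏ p ∈ Pd, (972 : ℝ) :=
          prod_le_prod (fun p _ => norm_nonneg _) fun p hp =>
            norm_localE_le_crude (hPp p (mem_filter.mp hp).1).two_le _ _ (hχ p) (hu p) (hv₁ p) (hv₂ p)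
      _ = 972 ^ Pd.card := prod_const _
      _ ≤ 972 ^ ω := pow_le_pow_right₀ (by norm_num) hPd_card
  -- (b) the good primes
  have hb : ‖∏ p ∈ Pg, MainTerm.localE p (Δ.factorization p) L (χp p) (u p) (v₁ p) (v₂ p)‖ ≤
      (4 * Real.log 2 ^ 2 * Real.exp (12 / Real.log 2 + ω + 3)) * (1 + S) * (Real.log R ^ 2)⁻¹ := by
    by_cases h2 : 2 ≤ R₁
    · -- `Pg ⊇ primes ≤ R₁` except those dividing `Δ`
      have hexp : ‖∏ p ∈ Pg, MainTerm.localE p (Δ.factorization p) L (χp p) (u p) (v₁ p) (v₂ p)‖ ≤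
          Real.exp (∑ p ∈ Pg, (-(2 / (p : ℝ)) + 4 * (S * (Real.log p / Real.log R) ^ 2) / p)) := by
        rw [norm_prod, Real.exp_sum]
        exact prod_le_prod (fun p _ => norm_nonneg _) fun p hp => (hnorm_le p (mem_filter.mp hp).1).1
      refine hexp.trans ?_
      rw [sum_add_distrib]
      -- the Taylor part: `≤ 3`
      have hT : ∑ p ∈ Pg, 4 * (S * (Real.log p / Real.log R) ^ 2) / p ≤ 3 := by
        have h1 : ∑ p ∈ Pg, 4 * (S * (Real.log p / Real.log R) ^ 2) / p =
            4 * S / Real.log R ^ 2 * ∑ p ∈ Pg, Real.log p ^ 2 / p := by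
          rw [mul_sum]; refine sum_congr rfl fun p _ => ?_; field_simp
        rw [h1]
        have h2' : ∑ p ∈ Pg, Real.log p ^ 2 / p ≤ ∑ p ∈ P.filter (fun p : ℕ => (p : ℝ) ≤ R₁), Real.log p ^ 2 / p := by
          refine sum_le_sum_of_subset_of_nonneg (fun p hp => ?_) fun p _ _ => by positivity
          rw [hPg, hPn, mem_filter, mem_filter] at hp
          exact mem_filter.mpr ⟨hp.1.1, hp.2⟩
        have h3 := MainTerm.sum_log_sq_div_filter_le hPp hR₁1
        rw [hlogR₁] at h3
        have hℓR : ℓ ^ 2 * (4 * S) = S / (1 + S) * Real.log R ^ 2 := by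
          rw [hℓ, div_pow, mul_pow, hsqsq]; field_simp; ring
        have hlog2ℓ : Real.log 2 ≤ ℓ := by rw [← hlogR₁]; exact Real.log_le_log two_pos h2
        have hlog2 : (0 : ℝ) < Real.log 2 := Real.log_pos one_lt_two
        have hlog4 : Real.log 4 = 2 * Real.log 2 := by
          rw [show (4 : ℝ) = 2 ^ 2 by norm_num, Real.log_pow]; push_cast; ring
        -- `4S ℓ (ℓ + log 4)/log²R = S/(1+S) + 2 S log4 /(√(1+S) log R) ≤ 1 + 2`
        have hkey : 4 * S / Real.log R ^ 2 * (ℓ * (ℓ + Real.log 4)) ≤ 3 := by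
          have hA : 4 * S / Real.log R ^ 2 * ℓ ^ 2 = S / (1 + S) := by
            rw [div_mul_eq_mul_div, mul_comm (4 * S), hℓR]; field_simp
          have hA1 : S / (1 + S) ≤ 1 := by rw [div_le_one (by linarith)]; linarith
          -- second part: `4 S ℓ log4 / log²R ≤ 4 S log4 ℓ/( (2 log2 √(1+S)) · (2√(1+S) ℓ))`… use `log R = 2√(1+S) ℓ ≥ 2 log 2 √(1+S)`
          have hlogReq : Real.log R = 2 * Real.sqrt (1 + S) * ℓ := by rw [hℓ]; field_simp
          have hB' : 4 * S / Real.log R ^ 2 * (ℓ * Real.log 4) = 2 * S * Real.log 2 / ((1 + S) * ℓ) := by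
            rw [hlogReq, hlog4]; field_simp; rw [hsqsq]; ring
          have hB1 : 2 * S * Real.log 2 / ((1 + S) * ℓ) ≤ 2 := by
            rw [div_le_iff₀ (by positivity)]
            nlinarith [hlog2ℓ, hS, hlog2]
          calc 4 * S / Real.log R ^ 2 * (ℓ * (ℓ + Real.log 4))
              = 4 * S / Real.log R ^ 2 * ℓ ^ 2 + 4 * S / Real.log R ^ 2 * (ℓ * Real.log 4) := by ring
            _ ≤ 1 + 2 := by rw [hA, hB']; exact add_le_add hA1 hB1
            _ = 3 := by norm_num
        calc 4 * S / Real.log R ^ 2 * ∑ p ∈ Pg, Real.log p ^ 2 / p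
            ≤ 4 * S / Real.log R ^ 2 * (ℓ * (ℓ + Real.log 4)) := mul_le_mul_of_nonneg_left (h2'.trans h3) (by positivity)
          _ ≤ 3 := hkey
      -- the gain part: `∑_{Pg} 1/p ≥ log log R₁ − log log 2 − 6/log 2 − ω/2`
      have hG : Real.log (Real.log R₁) - Real.log (Real.log 2) - 6 / Real.log 2 - ω / 2 ≤ ∑ p ∈ Pg, (1 : ℝ) / p := by
        have h1 := loglog_sub_loglog_le_sum_inv_prime_Icc (le_refl (2 : ℝ)) h2
        have hsub : (Icc ⌈(2 : ℝ)⌉₊ ⌊R₁⌋₊).filter Nat.Prime ⊆ P.filter (fun p : ℕ => (p : ℝ) ≤ R₁) := by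
          intro p hp
          rw [mem_filter, mem_Icc] at hp
          have hpR₁ : (p : ℝ) ≤ R₁ := (Nat.cast_le.mpr hp.1.2).trans (Nat.floor_le (by linarith))
          refine mem_filter.mpr ⟨Nat.mem_primesBelow.mpr ⟨?_, hp.2⟩, hpR₁⟩
          exact_mod_cast lt_of_le_of_lt hpR₁ hR₁R
        have h2' : ∑ p ∈ (Icc ⌈(2 : ℝ)⌉₊ ⌊R₁⌋₊).filter Nat.Prime, (1 : ℝ) / p ≤ ∑ p ∈ P.filter (fun p : ℕ => (p : ℝ) ≤ R₁), (1 : ℝ) / p :=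
          sum_le_sum_of_subset_of_nonneg hsub fun p _ _ => by positivity
        -- split `P.filter (≤ R₁)` into `Pg` and the part dividing `Δ`
        have h3 : ∑ p ∈ P.filter (fun p : ℕ => (p : ℝ) ≤ R₁), (1 : ℝ) / p ≤ ∑ p ∈ Pg, (1 : ℝ) / p + ω / 2 := by
          rw [← sum_filter_add_sum_filter_not (P.filter (fun p : ℕ => (p : ℝ) ≤ R₁)) (fun p => ¬p ∣ Δ)]
          have hfirst : (P.filter (fun p : ℕ => (p : ℝ) ≤ R₁)).filter (fun p => ¬p ∣ Δ) = Pg := by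
            rw [hPg, hPn, filter_filter, filter_filter]
            refine filter_congr fun p _ => ?_; tauto
          rw [hfirst]
          gcongr
          -- the part dividing `Δ`: at most `ω` primes, each `1/p ≤ 1/2`
          have hsub2 : (P.filter (fun p : ℕ => (p : ℝ) ≤ R₁)).filter (fun p => ¬¬p ∣ Δ) ⊆ Pd := by
            intro p hp
            rw [mem_filter, mem_filter] at hp
            rw [hPd, mem_filter]; exact ⟨hp.1.1, not_not.mp hp.2⟩
          calc ∑ p ∈ (P.filter (fun p : ℕ => (p : ℝ) ≤ R₁)).filter (fun p => ¬¬p ∣ Δ), (1 : ℝ) / p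
              ≤ ∑ p ∈ Pd, (1 : ℝ) / p := sum_le_sum_of_subset_of_nonneg hsub2 fun p _ _ => by positivity
            _ ≤ ∑ p ∈ Pd, (1 : ℝ) / 2 := sum_le_sum fun p hp =>
                div_le_div_of_nonneg_left zero_le_one two_pos (by exact_mod_cast (hPp p (mem_filter.mp hp).1).two_le)
            _ = Pd.card * (1 / 2) := by rw [sum_const, nsmul_eq_mul]
            _ ≤ ω / 2 := by
                have : (Pd.card : ℝ) ≤ ω := by exact_mod_cast hPd_card
                linarith
        linarith
      -- combine: `exp(−2Σ1/p + ΣTaylor) ≤ exp(−2(loglog R₁ − …) + 3)`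
      have hlogℓ : Real.log (Real.log R₁) = Real.log ℓ := by rw [hlogR₁]
      have hsumneg : ∑ p ∈ Pg, -(2 / (p : ℝ)) = -2 * ∑ p ∈ Pg, (1 : ℝ) / p := by
        rw [mul_sum]; refine sum_congr rfl fun p _ => ?_; ring
      rw [hsumneg]
      calc Real.exp (-2 * ∑ p ∈ Pg, (1 : ℝ) / p + ∑ p ∈ Pg, 4 * (S * (Real.log p / Real.log R) ^ 2) / p)
          ≤ Real.exp (-2 * (Real.log ℓ - Real.log (Real.log 2) - 6 / Real.log 2 - ω / 2) + 3) := by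
            refine Real.exp_le_exp.mpr ?_; rw [← hlogℓ]; nlinarith [hG, hT]
        _ = (4 * Real.log 2 ^ 2 * Real.exp (12 / Real.log 2 + ω + 3)) * (1 + S) * (Real.log R ^ 2)⁻¹ := by
            have hlog2 : (0 : ℝ) < Real.log 2 := Real.log_pos one_lt_two
            rw [show -2 * (Real.log ℓ - Real.log (Real.log 2) - 6 / Real.log 2 - ω / 2) + 3 =
              (12 / Real.log 2 + ω + 3) + 2 * Real.log (Real.log 2) + (-2) * Real.log ℓ by ring,
              Real.exp_add, Real.exp_add, show 2 * Real.log (Real.log 2) = Real.log (Real.log 2 ^ 2) by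
                rw [Real.log_pow]; push_cast; ring, Real.exp_log (by positivity),
              show (-2) * Real.log ℓ = Real.log (ℓ ^ 2)⁻¹ by rw [Real.log_inv, Real.log_pow]; push_cast; ring,
              Real.exp_log (by positivity), hℓ, div_pow, mul_pow, hsqsq]
            field_simp
            ring
    · -- `R₁ < 2`: no good primes; the bound is `≥ 1`
      have hempty : Pg = ∅ := by
        rw [hPg, filter_eq_empty_iff]
        intro p hp hle
        have := (hPp p (mem_filter.mp hp).1).two_le
        have : (2 : ℝ) ≤ p := by exact_mod_cast this
        linarith
      rw [hempty, prod_empty, norm_one]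
      -- `1 ≤ 4 log²2 e^{…} (1+S)/log²R` since `log R < 2 log 2 √(1+S)` i.e. `log²R ≤ 4 log²2 (1+S)`
      have hlt : ℓ < Real.log 2 := by
        rw [← hlogR₁]; exact Real.log_lt_log (by positivity) (not_le.mp h2)
      have hlogR2 : Real.log R ^ 2 ≤ 4 * Real.log 2 ^ 2 * (1 + S) := by
        have hlogReq : Real.log R = 2 * Real.sqrt (1 + S) * ℓ := by rw [hℓ]; field_simp
        rw [hlogReq]
        have : (2 * Real.sqrt (1 + S) * ℓ) ^ 2 = 4 * (1 + S) * ℓ ^ 2 := by rw [mul_pow, mul_pow, hsqsq]; ring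
        rw [this]
        have hℓ2 : ℓ ^ 2 ≤ Real.log 2 ^ 2 := pow_le_pow_left₀ hℓpos.le hlt.le 2
        nlinarith
      have hE1 : 1 ≤ Real.exp (12 / Real.log 2 + ω + 3) := Real.one_le_exp (by have := Real.log_pos one_lt_two; positivity)
      rw [← div_eq_mul_inv, le_div_iff₀ (by positivity), one_mul]
      calc Real.log R ^ 2 ≤ 4 * Real.log 2 ^ 2 * (1 + S) := hlogR2
        _ = 4 * Real.log 2 ^ 2 * 1 * (1 + S) := by ring
        _ ≤ 4 * Real.log 2 ^ 2 * Real.exp (12 / Real.log 2 + ω + 3) * (1 + S) := by gcongr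
  -- (c) the bad primes
  have hc : ‖∏ p ∈ Pb, MainTerm.localE p (Δ.factorization p) L (χp p) (u p) (v₁ p) (v₂ p)‖ ≤
      (Real.exp 720 * 2 ^ 30) * (1 + S) ^ 15 * Real.log N ^ 30 * (Real.log R ^ 30)⁻¹ := by
    have hexp : ‖∏ p ∈ Pb, MainTerm.localE p (Δ.factorization p) L (χp p) (u p) (v₁ p) (v₂ p)‖ ≤
        Real.exp (30 * ∑ p ∈ Pb, (1 : ℝ) / p) := by
      rw [norm_prod, mul_sum, Real.exp_sum]
      refine prod_le_prod (fun p _ => norm_nonneg _) fun p hp => ((hnorm_le p (mem_filter.mp hp).1).2).trans (le_of_eq ?_)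
      rw [mul_one_div]
    refine hexp.trans ?_
    -- `∑_{Pb} 1/p ≤ log log N − log log R₁' + 24` with `R₁' = max R₁ 2`
    have hlogReq : Real.log R = 2 * Real.sqrt (1 + S) * ℓ := by rw [hℓ]; field_simp
    by_cases h2 : 2 ≤ R₁
    · have hsub : Pb ⊆ P.filter (fun p : ℕ => R₁ < p ∧ (p : ℝ) ≤ N) := by
        intro p hp
        rw [hPb, hPn, mem_filter, mem_filter] at hp
        refine mem_filter.mpr ⟨hp.1.1, not_le.mp hp.2, ?_⟩
        exact_mod_cast (Nat.mem_primesBelow.mp hp.1.1).1.le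
      have h1 : ∑ p ∈ Pb, (1 : ℝ) / p ≤ Real.log (Real.log N) - Real.log (Real.log R₁) + 24 :=
        (sum_le_sum_of_subset_of_nonneg hsub fun p _ _ => by positivity).trans
          (MainTerm.sum_inv_filter_Ioc_le hPp h2 hR₁R.le)
      rw [hlogR₁] at h1
      calc Real.exp (30 * ∑ p ∈ Pb, (1 : ℝ) / p) ≤ Real.exp (30 * (Real.log (Real.log N) - Real.log ℓ + 24)) :=
            Real.exp_le_exp.mpr (by nlinarith [h1])
        _ = Real.exp 720 * (Real.log N ^ 30 * (ℓ ^ 30)⁻¹) := by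
            rw [show 30 * (Real.log (Real.log N) - Real.log ℓ + 24) = 720 + (30 : ℕ) * Real.log (Real.log N) + (30 : ℕ) * (-Real.log ℓ) by
              push_cast; ring, Real.exp_add, Real.exp_add, Real.exp_nat_mul, Real.exp_nat_mul, Real.exp_log hlogN,
              Real.exp_neg, Real.exp_log hℓpos, inv_pow]
            ring
        _ = (Real.exp 720 * 2 ^ 30) * Real.sqrt (1 + S) ^ 30 * Real.log N ^ 30 * (Real.log R ^ 30)⁻¹ := by
            rw [hlogReq]; field_simp
        _ ≤ (Real.exp 720 * 2 ^ 30) * (1 + S) ^ 15 * Real.log N ^ 30 * (Real.log R ^ 30)⁻¹ := by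
            have : Real.sqrt (1 + S) ^ 30 = (1 + S) ^ 15 := by rw [show 30 = 2 * 15 by norm_num, pow_mul, hsqsq]
            rw [this]
    · -- all `p ∤ Δ` are bad: `∑ 1/p ≤ log log N + 4`, and `log R ≤ 2√(1+S) log 2 ≤ 2√(1+S)`
      have h1 : ∑ p ∈ Pb, (1 : ℝ) / p ≤ Real.log (Real.log N) + 4 := by
        calc ∑ p ∈ Pb, (1 : ℝ) / p ≤ ∑ p ∈ Nat.primesLE N, (1 : ℝ) / p := by
              refine sum_le_sum_of_subset_of_nonneg (fun p hp => ?_) fun p _ _ => by positivity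
              rw [hPb, hPn, mem_filter, mem_filter, hP, Nat.mem_primesBelow] at hp
              exact Nat.mem_primesLE.mpr ⟨hp.1.1.1.le, hp.1.1.2⟩
          _ ≤ Real.log (Real.log N) + 4 := sum_inv_prime_le N hN
      have hlt : ℓ < Real.log 2 := by rw [← hlogR₁]; exact Real.log_lt_log (by positivity) (not_le.mp h2)
      have hlog2 : Real.log 2 < 1 := by have := Real.log_two_lt_d9; linarith
      have hratio : 1 ≤ 2 * Real.sqrt (1 + S) / Real.log R := by
        rw [le_div_iff₀ hlogR, hlogReq, one_mul]
        have := mul_le_mul_of_nonneg_left (hlt.le.trans hlog2.le) (by positivity : (0:ℝ) ≤ 2 * Real.sqrt (1 + S))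
        linarith
      calc Real.exp (30 * ∑ p ∈ Pb, (1 : ℝ) / p) ≤ Real.exp (30 * (Real.log (Real.log N) + 4)) :=
            Real.exp_le_exp.mpr (by nlinarith [h1])
        _ = Real.exp 120 * Real.log N ^ 30 := by
            rw [show 30 * (Real.log (Real.log N) + 4) = 120 + (30 : ℕ) * Real.log (Real.log N) by push_cast; ring,
              Real.exp_add, Real.exp_nat_mul, Real.exp_log hlogN]
        _ ≤ Real.exp 720 * Real.log N ^ 30 * (2 * Real.sqrt (1 + S) / Real.log R) ^ 30 := by
            have hA : Real.exp 120 ≤ Real.exp 720 := Real.exp_le_exp.mpr (by norm_num)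
            have hB : (1 : ℝ) ≤ (2 * Real.sqrt (1 + S) / Real.log R) ^ 30 := one_le_pow₀ hratio
            have h0 : 0 ≤ Real.exp 720 * Real.log N ^ 30 := by positivity
            nlinarith [hA, hB, h0, pow_nonneg hlogN.le 30]
        _ = (Real.exp 720 * 2 ^ 30) * Real.sqrt (1 + S) ^ 30 * Real.log N ^ 30 * (Real.log R ^ 30)⁻¹ := by
            rw [div_pow, mul_pow]; ring
        _ = (Real.exp 720 * 2 ^ 30) * (1 + S) ^ 15 * Real.log N ^ 30 * (Real.log R ^ 30)⁻¹ := by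
            have : Real.sqrt (1 + S) ^ 30 = (1 + S) ^ 15 := by rw [show 30 = 2 * 15 by norm_num, pow_mul, hsqsq]
            rw [this]
  -- assemble
  have hsplit : ∏ p ∈ P, MainTerm.localE p (Δ.factorization p) L (χp p) (u p) (v₁ p) (v₂ p) =
      (∏ p ∈ Pd, MainTerm.localE p (Δ.factorization p) L (χp p) (u p) (v₁ p) (v₂ p)) *
        ((∏ p ∈ Pg, MainTerm.localE p (Δ.factorization p) L (χp p) (u p) (v₁ p) (v₂ p)) *
          ∏ p ∈ Pb, MainTerm.localE p (Δ.factorization p) L (χp p) (u p) (v₁ p) (v₂ p)) := by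
    rw [hPg, hPb, prod_filter_mul_prod_filter_not, hPd, hPn, prod_filter_mul_prod_filter_not]
  rw [hsplit, norm_mul, norm_mul]
  have h0b : 0 ≤ (4 * Real.log 2 ^ 2 * Real.exp (12 / Real.log 2 + ω + 3)) * (1 + S) * (Real.log R ^ 2)⁻¹ := by positivity
  calc ‖∏ p ∈ Pd, MainTerm.localE p (Δ.factorization p) L (χp p) (u p) (v₁ p) (v₂ p)‖ *
        (‖∏ p ∈ Pg, MainTerm.localE p (Δ.factorization p) L (χp p) (u p) (v₁ p) (v₂ p)‖ *
          ‖∏ p ∈ Pb, MainTerm.localE p (Δ.factorization p) L (χp p) (u p) (v₁ p) (v₂ p)‖)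
      ≤ 972 ^ ω * (((4 * Real.log 2 ^ 2 * Real.exp (12 / Real.log 2 + ω + 3)) * (1 + S) * (Real.log R ^ 2)⁻¹) *
          ((Real.exp 720 * 2 ^ 30) * (1 + S) ^ 15 * Real.log N ^ 30 * (Real.log R ^ 30)⁻¹)) :=
        mul_le_mul ha (mul_le_mul hb hc (norm_nonneg _) h0b) (by positivity) (by positivity)
    _ = refinedConst ω * (1 + S) ^ 16 * Real.log N ^ 30 * (Real.log R ^ 32)⁻¹ := by
        unfold refinedConst; field_simp


/-! ### `KB2` for the kernel of the assembly -/

/-- **The Taylor bound for a sieve-slot unit**: `‖1 − p^{s}‖ ≤ (1 + 2π|t|) log p/log R` where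
`s = (−1 + 2πit)/log R` (`R > 1`, `p ≥ 1`). [cite: TaoTeravainen2021, §8 (8.22) ("Taylor expansion")] -/
theorem norm_one_sub_npow_sieve_le {X R : ℝ} (hR : 1 < R) (j : Fin 2) {i : Fin 3} (hi : i ≠ 0) (t : ℝ) {p : ℕ} (hp : p ≠ 0) :
    ‖1 - npow (slotExpo X R (j, i) t) p‖ ≤ (1 + 2 * π * |t|) * (Real.log p / Real.log R) := by
  have hlogR : 0 < Real.log R := Real.log_pos hR
  set z : ℂ := ((1 : ℂ) - 2 * π * t * I) / (Real.log R : ℂ) with hz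
  have hs : slotExpo X R (j, i) t = -z := by
    unfold slotExpo; simp only [hi, if_false, hz]; ring
  have hnpow : npow (slotExpo X R (j, i) t) p = (p : ℂ) ^ (-z) := by
    rw [hs]; unfold npow
    rw [Complex.cpow_def_of_ne_zero (Nat.cast_ne_zero.mpr hp), ← Complex.natCast_log, mul_comm]
  have hzre : 0 ≤ z.re := by
    rw [hz, Complex.div_ofReal_re]
    refine div_nonneg ?_ hlogR.le
    simp
  have hznorm : ‖z‖ ≤ (1 + 2 * π * |t|) / Real.log R := by
    rw [hz, norm_div, Complex.norm_real, Real.norm_eq_abs, abs_of_pos hlogR]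
    refine div_le_div_of_nonneg_right ?_ hlogR.le
    calc ‖(1 : ℂ) - 2 * π * t * I‖ ≤ ‖(1 : ℂ)‖ + ‖(2 : ℂ) * π * t * I‖ := norm_sub_le _ _
      _ = 1 + 2 * π * |t| := by
          rw [norm_one, norm_mul, norm_mul, norm_mul, Complex.norm_I, mul_one, Complex.norm_real, Complex.norm_real,
            Real.norm_eq_abs, Real.norm_eq_abs, abs_of_pos Real.pi_pos, Complex.norm_two]
  rw [hnpow]
  calc ‖1 - (p : ℂ) ^ (-z)‖ ≤ ‖z‖ * Real.log p := MainTerm.norm_one_sub_natCast_cpow_neg_le hp hzre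
    _ ≤ (1 + 2 * π * |t|) / Real.log R * Real.log p := mul_le_mul_of_nonneg_right hznorm (Real.log_natCast_nonneg p)
    _ = _ := by ring

/-- The polynomial `S(τ) = (1+2π|τ₀₁|)(1+2π|τ₀₂|) + (1+2π|τ₁₁|)(1+2π|τ₁₂|)` is dominated by the weight:
`(1 + S)^{16} ≤ (2π)^{80} · polyWeight X 16 τ` (`X ≥ 0`). [folklore] -/
theorem one_add_sieveS_pow_le {X : ℝ} (hX : 0 ≤ X) (τ : Slot → ℝ) :
    (1 + ((1 + 2 * π * |τ (0, 1)|) * (1 + 2 * π * |τ (0, 2)|) + (1 + 2 * π * |τ (1, 1)|) * (1 + 2 * π * |τ (1, 2)|))) ^ 16 ≤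
      (2 * π) ^ 80 * polyWeight X 16 τ := by
  have hπ := Real.pi_gt_three
  have hπ0 : 0 < 2 * π := by linarith
  -- abbreviations (plain `have`s, no `set`, to keep terms small)
  have ha : 0 ≤ |τ (0, 1)| := abs_nonneg _
  have hb : 0 ≤ |τ (0, 2)| := abs_nonneg _
  have hc : 0 ≤ |τ (1, 1)| := abs_nonneg _
  have hd : 0 ≤ |τ (1, 2)| := abs_nonneg _
  have hlin : ∀ {t : ℝ}, 0 ≤ t → 1 + 2 * π * t ≤ 2 * π * (1 + t) := fun {t} _ => by linarith
  have hx : (1 + 2 * π * |τ (0, 1)|) * (1 + 2 * π * |τ (0, 2)|) ≤ (2 * π * (1 + |τ (0, 1)|)) * (2 * π * (1 + |τ (0, 2)|)) :=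
    mul_le_mul (hlin ha) (hlin hb) (by positivity) (by positivity)
  have hy : (1 + 2 * π * |τ (1, 1)|) * (1 + 2 * π * |τ (1, 2)|) ≤ (2 * π * (1 + |τ (1, 1)|)) * (2 * π * (1 + |τ (1, 2)|)) :=
    mul_le_mul (hlin hc) (hlin hd) (by positivity) (by positivity)
  have h1a : 1 ≤ 2 * π * (1 + |τ (0, 1)|) := by nlinarith
  have h1b : 1 ≤ 2 * π * (1 + |τ (0, 2)|) := by nlinarith
  have h1c : 1 ≤ 2 * π * (1 + |τ (1, 1)|) := by nlinarith
  have h1d : 1 ≤ 2 * π * (1 + |τ (1, 2)|) := by nlinarith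
  have hxx1 : 1 ≤ (2 * π * (1 + |τ (0, 1)|)) * (2 * π * (1 + |τ (0, 2)|)) := one_le_mul_of_one_le_of_one_le h1a h1b
  have hyy1 : 1 ≤ (2 * π * (1 + |τ (1, 1)|)) * (2 * π * (1 + |τ (1, 2)|)) := one_le_mul_of_one_le_of_one_le h1c h1d
  -- `1 + xx + yy ≤ 2π xx yy` for `xx, yy ≥ 1`
  have hkey : ∀ {xx yy : ℝ}, 1 ≤ xx → 1 ≤ yy → 1 + xx + yy ≤ 2 * π * (xx * yy) := by
    intro xx yy hxx hyy
    have h1 : xx ≤ xx * yy := le_mul_of_one_le_right (by linarith) hyy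
    have h2 : yy ≤ xx * yy := le_mul_of_one_le_left (by linarith) hxx
    have h3 : 1 ≤ xx * yy := one_le_mul_of_one_le_of_one_le hxx hyy
    have h5 : 3 * (xx * yy) ≤ 2 * π * (xx * yy) := mul_le_mul_of_nonneg_right (by linarith) (by linarith)
    linarith
  have hS : 1 + ((1 + 2 * π * |τ (0, 1)|) * (1 + 2 * π * |τ (0, 2)|) + (1 + 2 * π * |τ (1, 1)|) * (1 + 2 * π * |τ (1, 2)|)) ≤
      (2 * π) ^ 5 * ((1 + |τ (0, 1)|) * (1 + |τ (0, 2)|) * (1 + |τ (1, 1)|) * (1 + |τ (1, 2)|)) := by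
    have h := hkey hxx1 hyy1
    have e : 2 * π * ((2 * π * (1 + |τ (0, 1)|)) * (2 * π * (1 + |τ (0, 2)|)) * ((2 * π * (1 + |τ (1, 1)|)) * (2 * π * (1 + |τ (1, 2)|)))) =
        (2 * π) ^ 5 * ((1 + |τ (0, 1)|) * (1 + |τ (0, 2)|) * (1 + |τ (1, 1)|) * (1 + |τ (1, 2)|)) := by ring
    linarith
  have hbase : 0 ≤ 1 + ((1 + 2 * π * |τ (0, 1)|) * (1 + 2 * π * |τ (0, 2)|) + (1 + 2 * π * |τ (1, 1)|) * (1 + 2 * π * |τ (1, 2)|)) := by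
    positivity
  -- the weight
  have hW : ((1 + |τ (0, 1)|) * (1 + |τ (0, 2)|) * (1 + |τ (1, 1)|) * (1 + |τ (1, 2)|)) ^ 16 ≤ polyWeight X 16 τ := by
    unfold polyWeight
    rw [Fintype.prod_prod_type, Fin.prod_univ_two, Fin.prod_univ_three, Fin.prod_univ_three]
    simp only [slotPoly, Fin.isValue, if_true, show ((1 : Fin 3) = 0) = False by decide,
      show ((2 : Fin 3) = 0) = False by decide, if_false]
    have hd0 : 1 ≤ (1 + X * |τ (0, 0)|) ^ 16 := one_le_pow₀ (by have := abs_nonneg (τ (0,0)); nlinarith)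
    have hd1 : 1 ≤ (1 + X * |τ (1, 0)|) ^ 16 := one_le_pow₀ (by have := abs_nonneg (τ (1,0)); nlinarith)
    have e : ((1 + |τ (0, 1)|) * (1 + |τ (0, 2)|) * (1 + |τ (1, 1)|) * (1 + |τ (1, 2)|)) ^ 16 =
        1 * (1 + |τ (0, 1)|) ^ 16 * (1 + |τ (0, 2)|) ^ 16 * (1 * (1 + |τ (1, 1)|) ^ 16 * (1 + |τ (1, 2)|) ^ 16) := by
      rw [mul_pow, mul_pow, mul_pow, one_mul, one_mul, mul_assoc]
    rw [e]
    gcongr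
  calc (1 + ((1 + 2 * π * |τ (0, 1)|) * (1 + 2 * π * |τ (0, 2)|) + (1 + 2 * π * |τ (1, 1)|) * (1 + 2 * π * |τ (1, 2)|))) ^ 16
      ≤ ((2 * π) ^ 5 * ((1 + |τ (0, 1)|) * (1 + |τ (0, 2)|) * (1 + |τ (1, 1)|) * (1 + |τ (1, 2)|))) ^ 16 :=
        pow_le_pow_left₀ hbase hS 16
    _ = (2 * π) ^ 80 * ((1 + |τ (0, 1)|) * (1 + |τ (0, 2)|) * (1 + |τ (1, 1)|) * (1 + |τ (1, 2)|)) ^ 16 := by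
        rw [mul_pow, ← pow_mul]
    _ ≤ (2 * π) ^ 80 * polyWeight X 16 τ := mul_le_mul_of_nonneg_left hW (by positivity)


/-- **The refined bound at the kernel's side data** (generic scales `X > 0`, `1 < R ≤ N`): with
`S(τ) = (1+2π|τ₀₁|)(1+2π|τ₀₂|) + (1+2π|τ₁₁|)(1+2π|τ₁₂|)`,
`‖∏_{p<N} E_p(τ)‖ ≤ refinedConst(ω) (1+S(τ))^{16} (log N)^{30} (log R)^{-32}`.
[cite: TaoTeravainen2021, §8 (8.20)] -/
theorem norm_prod_localE_refined_slot (χ : DirichletCharacter ℂ q) {X R : ℝ} (hX : 0 < X) (hR : 1 < R)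
    {h₁ h₂ : ℕ} (hne : h₁ ≠ h₂) {A : ℕ} (hA : 1 ≤ A) {N : ℕ} (hN : 2 ≤ N) (hRN : R ≤ N) (τ : Slot → ℝ) :
    ‖∏ p ∈ Nat.primesBelow N, MainTerm.localE p ((shiftDiff h₁ h₂).factorization p) A (realChar χ p)
        (fun j => npow (slotExpo X R (j, 0) (τ (j, 0))) p)
        (fun j => npow (slotExpo X R (j, 1) (τ (j, 1))) p)
        (fun j => npow (slotExpo X R (j, 2) (τ (j, 2))) p)‖ ≤
      refinedConst (shiftDiff h₁ h₂).primeFactors.card *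
        (1 + ((1 + 2 * π * |τ (0, 1)|) * (1 + 2 * π * |τ (0, 2)|) +
          (1 + 2 * π * |τ (1, 1)|) * (1 + 2 * π * |τ (1, 2)|))) ^ 16 *
        Real.log N ^ 30 * (Real.log R ^ 32)⁻¹ := by
  have hΔ : shiftDiff h₁ h₂ ≠ 0 := shiftDiff_ne_zero hne
  -- norms of the units
  have hre : ∀ k : Slot, ∀ t : ℝ, (slotExpo X R k t).re ≤ 0 := by
    intro k t
    unfold slotExpo
    split_ifs
    · simp only [Complex.add_re, Complex.neg_re, Complex.ofReal_re, Complex.mul_re, Complex.re_ofNat,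
        Complex.ofReal_im, Complex.im_ofNat, Complex.I_re, Complex.I_im, Complex.mul_im]
      have : 0 < X⁻¹ := by positivity
      nlinarith
    · rw [Complex.div_ofReal_re]
      refine div_nonpos_of_nonpos_of_nonneg ?_ (Real.log_pos hR).le
      simp
  have hnorm : ∀ (k : Slot) (t : ℝ) (p : ℕ), p ∈ Nat.primesBelow N → ‖npow (slotExpo X R k t) p‖ ≤ 1 :=
    fun k t p hp => norm_npow_le_one (hre k t) (Nat.prime_of_mem_primesBelow hp).one_le
  have hS0 : 0 ≤ (1 + 2 * π * |τ (0, 1)|) * (1 + 2 * π * |τ (0, 2)|) +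
      (1 + 2 * π * |τ (1, 1)|) * (1 + 2 * π * |τ (1, 2)|) := by positivity
  classical
  have h := norm_prod_localE_refined hΔ hA hN hR hRN (fun p => realChar χ p) (fun p => abs_realChar_le_one χ p)
    (fun p j => if p ∈ Nat.primesBelow N then npow (slotExpo X R (j, 0) (τ (j, 0))) p else 1)
    (fun p j => if p ∈ Nat.primesBelow N then npow (slotExpo X R (j, 1) (τ (j, 1))) p else 1)
    (fun p j => if p ∈ Nat.primesBelow N then npow (slotExpo X R (j, 2) (τ (j, 2))) p else 1)
    (fun p j => by by_cases hp : p ∈ Nat.primesBelow N <;> simp only [hp, if_true, if_false, norm_one, le_refl]; exact hnorm _ _ p hp)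
    (fun p j => by by_cases hp : p ∈ Nat.primesBelow N <;> simp only [hp, if_true, if_false, norm_one, le_refl]; exact hnorm _ _ p hp)
    (fun p j => by by_cases hp : p ∈ Nat.primesBelow N <;> simp only [hp, if_true, if_false, norm_one, le_refl]; exact hnorm _ _ p hp)
    hS0 (fun p hp => by
      simp only [hp, if_true]
      have hp0 : p ≠ 0 := (Nat.prime_of_mem_primesBelow hp).ne_zero
      have hlp : 0 ≤ Real.log p / Real.log R := div_nonneg (Real.log_natCast_nonneg p) (Real.log_pos hR).le
      have h01 := norm_one_sub_npow_sieve_le (X := X) hR 0 (i := 1) (by decide) (τ (0, 1)) hp0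
      have h02 := norm_one_sub_npow_sieve_le (X := X) hR 0 (i := 2) (by decide) (τ (0, 2)) hp0
      have h11 := norm_one_sub_npow_sieve_le (X := X) hR 1 (i := 1) (by decide) (τ (1, 1)) hp0
      have h12 := norm_one_sub_npow_sieve_le (X := X) hR 1 (i := 2) (by decide) (τ (1, 2)) hp0
      have hA : ‖1 - npow (slotExpo X R (0, 1) (τ (0, 1))) p‖ * ‖1 - npow (slotExpo X R (0, 2) (τ (0, 2))) p‖ ≤
          ((1 + 2 * π * |τ (0, 1)|) * (Real.log p / Real.log R)) * ((1 + 2 * π * |τ (0, 2)|) * (Real.log p / Real.log R)) :=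
        mul_le_mul h01 h02 (norm_nonneg _) (by positivity)
      have hB : ‖1 - npow (slotExpo X R (1, 1) (τ (1, 1))) p‖ * ‖1 - npow (slotExpo X R (1, 2) (τ (1, 2))) p‖ ≤
          ((1 + 2 * π * |τ (1, 1)|) * (Real.log p / Real.log R)) * ((1 + 2 * π * |τ (1, 2)|) * (Real.log p / Real.log R)) :=
        mul_le_mul h11 h12 (norm_nonneg _) (by positivity)
      have e : ((1 + 2 * π * |τ (0, 1)|) * (Real.log p / Real.log R)) * ((1 + 2 * π * |τ (0, 2)|) * (Real.log p / Real.log R)) +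
          ((1 + 2 * π * |τ (1, 1)|) * (Real.log p / Real.log R)) * ((1 + 2 * π * |τ (1, 2)|) * (Real.log p / Real.log R)) =
          ((1 + 2 * π * |τ (0, 1)|) * (1 + 2 * π * |τ (0, 2)|) + (1 + 2 * π * |τ (1, 1)|) * (1 + 2 * π * |τ (1, 2)|)) *
            (Real.log p / Real.log R) ^ 2 := by ring
      exact (add_le_add hA hB).trans_eq e)
  refine le_trans (le_of_eq ?_) h
  congr 1
  refine prod_congr rfl fun p hp => ?_
  simp only [hp, if_true]

/-- Bookkeeping for `KB2`: `C (1+S)^{16} L^{30} ((X/ℓ)^{32})^{-1} ≤ C 2^{30} (2π)^{80} ℓ^{32} X^{-2} P` when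
`L ≤ 2X` and `(1+S)^{16} ≤ (2π)^{80} P`. [folklore] -/
theorem kb2_arith {C P S L X ℓ : ℝ} (hC : 0 ≤ C) (hS : 0 ≤ S) (hX : 0 < X) (hℓ : 0 < ℓ)
    (hL0 : 0 ≤ L) (hL : L ≤ 2 * X) (hSw : (1 + S) ^ 16 ≤ (2 * π) ^ 80 * P) :
    C * (1 + S) ^ 16 * L ^ 30 * ((X / ℓ) ^ 32)⁻¹ ≤ C * 2 ^ 30 * (2 * π) ^ 80 * ℓ ^ 32 * (X ^ 2)⁻¹ * P := by
  have h30 : L ^ 30 ≤ 2 ^ 30 * X ^ 30 := by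
    calc L ^ 30 ≤ (2 * X) ^ 30 := pow_le_pow_left₀ hL0 hL 30
      _ = 2 ^ 30 * X ^ 30 := mul_pow _ _ _
  have h32 : ((X / ℓ) ^ 32)⁻¹ = ℓ ^ 32 * (X ^ 32)⁻¹ := by rw [div_pow, inv_div, div_eq_mul_inv]
  have hXX : X ^ 30 * (X ^ 32)⁻¹ = (X ^ 2)⁻¹ := by
    rw [show X ^ 32 = X ^ 30 * X ^ 2 by ring, mul_inv, ← mul_assoc, mul_inv_cancel₀ (by positivity), one_mul]
  have key : (1 + S) ^ 16 * L ^ 30 ≤ ((2 * π) ^ 80 * P) * (2 ^ 30 * X ^ 30) :=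
    mul_le_mul hSw h30 (by positivity) ((pow_nonneg (by linarith) 16).trans hSw)
  have hw : 0 ≤ ℓ ^ 32 * (X ^ 32)⁻¹ := by positivity
  calc C * (1 + S) ^ 16 * L ^ 30 * ((X / ℓ) ^ 32)⁻¹ = C * ((1 + S) ^ 16 * L ^ 30) * (ℓ ^ 32 * (X ^ 32)⁻¹) := by
        rw [h32]; ring
    _ ≤ C * (((2 * π) ^ 80 * P) * (2 ^ 30 * X ^ 30)) * (ℓ ^ 32 * (X ^ 32)⁻¹) :=
        mul_le_mul_of_nonneg_right (mul_le_mul_of_nonneg_left key hC) hw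
    _ = C * 2 ^ 30 * (2 * π) ^ 80 * ℓ ^ 32 * (X ^ 30 * (X ^ 32)⁻¹) * P := by ring
    _ = _ := by rw [hXX]

/-- `log (x+1) ≤ 2 log x` for natural `x ≥ 2`. [folklore] -/
theorem log_succ_le_two_mul_log {x : ℕ} (hx : 2 ≤ x) : Real.log ((x + 1 : ℕ) : ℝ) ≤ 2 * Real.log (x : ℝ) := by
  have hx2 : (2 : ℝ) ≤ x := by exact_mod_cast hx
  have h2 : ((x + 1 : ℕ) : ℝ) ≤ (x : ℝ) ^ 2 := by push_cast; nlinarith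
  calc Real.log ((x + 1 : ℕ) : ℝ) ≤ Real.log ((x : ℝ) ^ 2) := Real.log_le_log (by positivity) h2
    _ = 2 * Real.log (x : ℝ) := by rw [Real.log_pow]; norm_num

/-- **`KB2` for the kernel of the assembly** (all Fourier variables, `κ = 16`, `c₂ = 16/5`): for
`h₁ ≠ h₂`, `A ≥ 1`, `x ≥ 2` (natural), `η ≥ 10`:
`‖K(τ)‖ ≤ refinedConst(ω) 2^{30} (2π)^{80} (log η)^{16/5} (log x)^{-2} polyWeight (log x) 16 τ`.
[cite: TaoTeravainen2021, §8 (8.20)] -/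
theorem kernel_KB2_explicit (χ : DirichletCharacter ℂ q) {h₁ h₂ : ℕ} (hne : h₁ ≠ h₂) {η : ℝ} (hη : 10 ≤ η)
    {x : ℕ} (hx : 2 ≤ x) {A : ℕ} (hA : 1 ≤ A) (τ : Slot → ℝ) :
    ‖assemblyKernel χ h₁ h₂ η x A τ‖ ≤
      refinedConst (shiftDiff h₁ h₂).primeFactors.card * 2 ^ 30 * (2 * π) ^ 80 * Real.log η ^ ((16 : ℝ) / 5) *
        (Real.log x ^ 2)⁻¹ * polyWeight (Real.log x) 16 τ := by
  have hx1 : (1 : ℝ) < x := by exact_mod_cast hx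
  have hx0 : (0 : ℝ) < x := by linarith
  have hX0 : 0 < Real.log x := Real.log_pos hx1
  have hη1 : (1 : ℝ) < η := by linarith
  have hLη0 : 0 ≤ Real.log η := Real.log_nonneg hη1.le
  have hLη : 1 ≤ Real.log η := by
    rw [← Real.log_exp 1]; refine Real.log_le_log (Real.exp_pos 1) ?_; have := Real.exp_one_lt_d9; linarith
  have hℓpos : 0 < Real.log η ^ ((1 : ℝ) / 10) := Real.rpow_pos_of_pos (by linarith) _
  have hℓ1 : 1 ≤ Real.log η ^ ((1 : ℝ) / 10) := Real.one_le_rpow hLη (by norm_num)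
  have hR1 : 1 < pairScaleR η x := Real.one_lt_rpow hx1 (one_div_pos.mpr hℓpos)
  have hlogR : Real.log (pairScaleR η x) = Real.log x / Real.log η ^ ((1 : ℝ) / 10) := by
    rw [pairScaleR, Real.log_rpow hx0]; ring
  have hRx : pairScaleR η x ≤ ((x + 1 : ℕ) : ℝ) := by
    calc pairScaleR η x = (x : ℝ) ^ (1 / Real.log η ^ ((1 : ℝ) / 10)) := rfl
      _ ≤ (x : ℝ) ^ (1 : ℝ) := Real.rpow_le_rpow_of_exponent_le hx1.le ((div_le_one hℓpos).mpr hℓ1)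
      _ = x := Real.rpow_one _
      _ ≤ ((x + 1 : ℕ) : ℝ) := by exact_mod_cast Nat.le_succ x
  have hS0 : 0 ≤ (1 + 2 * π * |τ (0, 1)|) * (1 + 2 * π * |τ (0, 2)|) +
      (1 + 2 * π * |τ (1, 1)|) * (1 + 2 * π * |τ (1, 2)|) := by positivity
  have harith := kb2_arith (P := polyWeight (Real.log x) 16 τ) (refinedConst_nonneg (shiftDiff h₁ h₂).primeFactors.card)
    hS0 hX0 hℓpos (Real.log_natCast_nonneg (x + 1)) (log_succ_le_two_mul_log hx) (one_add_sieveS_pow_le hX0.le τ)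
  have hℓ32 : (Real.log η ^ ((1 : ℝ) / 10)) ^ 32 = Real.log η ^ ((16 : ℝ) / 5) := by
    rw [← Real.rpow_mul_natCast hLη0]; norm_num
  rw [← hℓ32]
  have h := norm_prod_localE_refined_slot χ hX0 hR1 hne hA (by omega : 2 ≤ x + 1) hRx τ
  rw [hlogR] at h
  unfold assemblyKernel
  exact h.trans harith

/-- **`KB2` in the form consumed by `prop72_81_pair_of_kernelBounds`.** [cite: TaoTeravainen2021, §8 (8.20)] -/
theorem kernel_KB2 : ∀ h₁ h₂ : ℕ, 1 ≤ h₁ → 1 ≤ h₂ → h₁ ≠ h₂ →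
    ∃ κ : ℕ, 2 ≤ κ ∧ ∃ C₂ c₂ η₂ : ℝ, 0 ≤ C₂ ∧ 0 ≤ c₂ ∧
      ∀ (q : ℕ) [NeZero q] (χ : DirichletCharacter ℂ q) (η : ℝ), IsSiegelZero χ η → η₂ ≤ η →
        ∀ x : ℕ, (q : ℝ) ^ ((41 : ℝ) / 2) ≤ x → (x : ℝ) ≤ (q : ℝ) ^ Real.sqrt η →
          ∀ A : ℕ, 1 ≤ A → ∀ τ : Slot → ℝ,
            (∀ k, |τ k| ≤ boxThr (Real.log x) ((Real.log x) ^ ((1 : ℝ) / 20)) k) →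
              ‖assemblyKernel χ h₁ h₂ η x A τ‖ ≤
                C₂ * (Real.log η) ^ c₂ * ((Real.log x) ^ 2)⁻¹ * polyWeight (Real.log x) κ τ := by
  intro h₁ h₂ _ _ hne
  refine ⟨16, by norm_num, refinedConst (shiftDiff h₁ h₂).primeFactors.card * 2 ^ 30 * (2 * π) ^ 80, (16 : ℝ) / 5, 0,
    by have := refinedConst_nonneg (shiftDiff h₁ h₂).primeFactors.card; positivity, by norm_num,
    fun q _ χ η hS _ x hx _ A hA τ _ => ?_⟩
  have hq3 : (3 : ℝ) ≤ q := by exact_mod_cast hS.three_le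
  have hx2 : 2 ≤ x := by
    have h1 : (3 : ℝ) ≤ x := by
      calc (3 : ℝ) ≤ q := hq3
        _ = (q : ℝ) ^ (1 : ℝ) := (Real.rpow_one _).symm
        _ ≤ (q : ℝ) ^ ((41 : ℝ) / 2) := Real.rpow_le_rpow_of_exponent_le (by linarith) (by norm_num)
        _ ≤ x := hx
    exact_mod_cast (show (2 : ℝ) ≤ x by linarith)
  exact kernel_KB2_explicit χ hne hS.ten_le hx2 hA τ

end TaoTeravainen

end Literature.Barriers.Parity
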